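import Summits.CriticalPhenomena.CardyFormulaZ2.Theorems.CardySelfDualSegmentUniformBoxCrossingDefs2
import HarnessLib

/-!
# Stub `stub_assembly`, part 2 (crux stmt-CriticalPhenomena-5476 `UniformBoxCrossing`, line `Sketch`):
# bookkeeping — the examined coins are a stopping set; measurability of the events of the
# resampling argument

Bollobás–Riordan, *Percolation on self-dual polygon configurations* (2010, arXiv:1001.4674),
§5.1, proof of Theorem 5.3, transplanted to the corner models `M_t = cornerPercolation t`
(coins indexed by `Site 2 × Fin 2`). This file supplies the measure-theoretic bookkeeping of the
probabilistic wrapping (`…StubAssemblyPart4.lean`):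

* `isStoppingSet_examinedCoins` — under `ExaminedStatement` (coins agreeing on the examined coins
  give the same explored face sets) the examined coins `examinedCoins n s` form a stopping set
  (`IsStoppingSet`, `ProdBernoulliSplice.lean`), so `brSplice n s` is an instance of B–R's
  measure-preserving `f_ALG`.
* `measurableSet_setOf_of_invariant` — the measurability device: a predicate invariant under a
  map with countably many values and measurable fibres defines a measurable set.
* Measurable fibres of the explored data `explData n s ω = (dualBelow n ω, dualAbove n s ω)`
  (locality `determinedBy_dualBelow_eq`, measurability of the reflection `reflConfig`), whence
  `measurableSet_smallGapEvent`; `measurableSet_nonSlant`.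
* The resampling datum `q = (S₁, S₂, X)` enters the link walk, the junction data and the
  good-shift event `goodSet` only through `brData n s m q = (explData (cornerConfig S₁),
  coins of S₂ in the square [0,m]², X)` (`nsPath_cornerConfig_congr`: the chosen non-slant path
  is a function of the coins of the corners in the square), which has measurable fibres; hence
  `measurableSet_goodSet`, `measurableSet_juncSite_juncPattern_eq`, `measurableSet_juncSite_eq` —
  the measurability inputs of `mul_prod_le_of_reconstructible` and of Fubini.
-/

noncomputable section

namespace Summit.CriticalPhenomena.CardyFormulaZ2.Cruxes.UniformBoxCrossing.NonSlantLine

open MeasureTheory SimpleGraph Finset Literature.Probability.Percolation Literature.Probability.LatticeModels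

/-! ### The examined coins form a stopping set -/

/-- **The examined coins are a stopping set** (Bollobás–Riordan's `𝒮_ALG` for the two
explorations): if `S`, `S'` agree on `E = examinedCoins n s S` then they produce the same explored
face sets (`ExaminedStatement`), hence the same examined coins.
[cite: BollobasRiordan2010, §5.1 proof of Thm. 5.3] -/
theorem isStoppingSet_examinedCoins (hE : ExaminedStatement) (n s : ℕ) :
    IsStoppingSet (examinedCoins n s) := by
  intro E
  rw [determinedBy_iff]
  suffices key : ∀ S S' : Set (Site 2 × Fin 2), S ∩ ↑E = S' ∩ ↑E →
      examinedCoins n s S = E → examinedCoins n s S' = E from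
    fun S S' h => ⟨key S S' h, key S' S h.symm⟩
  intro S S' hSS' hS
  have hagree : ∀ i ∈ examinedCoins n s S, i ∈ S ↔ i ∈ S' := by
    intro i hi
    have hiE : i ∈ (↑E : Set (Site 2 × Fin 2)) := by
      rw [← hS]
      exact Finset.mem_coe.2 hi
    exact ⟨fun h => ((Set.ext_iff.1 hSS' i).1 ⟨h, hiE⟩).1,
      fun h => ((Set.ext_iff.1 hSS' i).2 ⟨h, hiE⟩).1⟩
  obtain ⟨h₁, h₂⟩ := hE n s S S' hagree
  rw [← hS]
  exact examinedCoins_eq_of_eq n s h₁ h₂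

/-! ### A measurability device -/

/-- **Measurability by invariance**: if `p` is invariant under a map `f` with countably many
values and measurable fibres, then `{a | p a}` is measurable (it is the union of the fibres it
meets). [folklore] -/
theorem measurableSet_setOf_of_invariant {α β : Type*} [MeasurableSpace α] [Countable β]
    (f : α → β) (hf : ∀ b, MeasurableSet (f ⁻¹' {b})) {p : α → Prop}
    (hp : ∀ a a', f a = f a' → p a → p a') : MeasurableSet {a | p a} := by
  have h : {a | p a} = ⋃ b : β, f ⁻¹' {b} ∩ {_a | ∃ a₀, f a₀ = b ∧ p a₀} := by
    ext a
    simp only [Set.mem_setOf_eq, Set.mem_iUnion, Set.mem_inter_iff, Set.mem_preimage,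
      Set.mem_singleton_iff]
    exact ⟨fun ha => ⟨f a, rfl, a, rfl, ha⟩,
      fun ⟨b, hb, a₀, ha₀, hpa₀⟩ => hp a₀ a (ha₀.trans hb.symm) hpa₀⟩
  rw [h]
  exact MeasurableSet.iUnion fun b => (hf b).inter (MeasurableSet.const _)

/-- Fibres of a pair of maps with measurable fibres are measurable. [folklore] -/
theorem measurableSet_fibre_prodMk {α β γ : Type*} [MeasurableSpace α] {f : α → β} {g : α → γ}
    (hf : ∀ b, MeasurableSet (f ⁻¹' {b})) (hg : ∀ c, MeasurableSet (g ⁻¹' {c})) (x : β × γ) :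
    MeasurableSet ((fun a => (f a, g a)) ⁻¹' {x}) := by
  have : (fun a => (f a, g a)) ⁻¹' {x} = f ⁻¹' {x.1} ∩ g ⁻¹' {x.2} := by
    ext a
    simp only [Set.mem_preimage, Set.mem_singleton_iff, Set.mem_inter_iff, Prod.ext_iff]
  rw [this]
  exact (hf _).inter (hg _)

/-- Fibres of `g ∘ f` are measurable when `f` has countably many values and measurable fibres.
[folklore] -/
theorem measurableSet_fibre_comp {α β γ : Type*} [MeasurableSpace α] [Countable β] {f : α → β}
    (hf : ∀ b, MeasurableSet (f ⁻¹' {b})) (g : β → γ) (c : γ) :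
    MeasurableSet ((g ∘ f) ⁻¹' {c}) :=
  measurableSet_setOf_of_invariant f hf (p := fun a => g (f a) = c) fun a a' h ha => by
    rw [← h]
    exact ha

/-! ### The explored data have measurable fibres -/

/-- The level sets of the exploration from below are measurable (local events,
`determinedBy_dualBelow_eq`). [folklore] -/
theorem measurableSet_dualBelow_fibre (n : ℕ) (a : Finset (Site 2)) :
    MeasurableSet ((dualBelow n) ⁻¹' {a}) :=
  (determinedBy_dualBelow_eq n a).measurableSet_of_finset

/-- The reflection of configurations is measurable. [folklore] -/
theorem measurable_reflConfig (n s : ℕ) : Measurable (reflConfig n s) := by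
  refine measurable_set_iff.2 fun e => ?_
  have : (fun ω : BondConfig (Site 2) => e ∈ reflConfig n s ω) =
      fun ω => e.map (upperRefl n s) ∈ ω := by
    funext ω
    exact propext (mem_reflConfig_iff n s ω e)
  rw [this]
  exact measurable_set_mem _

/-- The level sets of the exploration from above are measurable. [folklore] -/
theorem measurableSet_dualAbove_fibre (n s : ℕ) (b : Finset (Site 2)) :
    MeasurableSet ((dualAbove n s) ⁻¹' {b}) :=
  measurableSet_fibre_comp (f := dualBelow n ∘ reflConfig n s)
    (fun a => measurable_reflConfig n s (measurableSet_dualBelow_fibre n a))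
    (fun D => D.image (reflY ((n : ℤ) + s - 1))) b

/-- The explored data of a configuration: the face sets explored from below in `[0, n]²` and
from above in `[0, n] × [s, n + s]`. [cite: BollobasRiordan2010, §5.1 proof of Thm. 5.3] -/
def explData (n s : ℕ) (ω : BondConfig (Site 2)) : Finset (Site 2) × Finset (Site 2) :=
  (dualBelow n ω, dualAbove n s ω)

/-- The explored data have measurable fibres. [folklore] -/
theorem measurableSet_explData_fibre (n s : ℕ) (d : Finset (Site 2) × Finset (Site 2)) :
    MeasurableSet ((explData n s) ⁻¹' {d}) :=
  measurableSet_fibre_prodMk (measurableSet_dualBelow_fibre n) (measurableSet_dualAbove_fibre n s) d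

/-- The explored data of the corner configuration have measurable fibres. [folklore] -/
theorem measurableSet_explData_cornerConfig_fibre (n s : ℕ) (d : Finset (Site 2) × Finset (Site 2)) :
    MeasurableSet ((explData n s ∘ cornerConfig) ⁻¹' {d}) :=
  measurable_cornerConfig (measurableSet_explData_fibre n s d)

/-- The gap only depends on the explored data. [folklore] -/
theorem gap_congr (n s : ℕ) {ω ω' : BondConfig (Site 2)} (h₁ : dualBelow n ω = dualBelow n ω')
    (h₂ : dualAbove n s ω = dualAbove n s ω') : gap n s ω = gap n s ω' := by
  ext v
  rw [mem_gap_iff, mem_gap_iff, lowerRegion_congr n h₁, upperRegion_congr n s h₂]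

/-- The event `H(S₂)` is measurable. [folklore] -/
theorem measurableSet_upperLR (n s : ℕ) : MeasurableSet (upperLR n s) :=
  measurableSet_openCrossing_of_countable _ _ _

/-- **The small-gap event `G_ε` is measurable**: two crossing events, and two clauses that depend
on `ω` only through the explored data. [folklore] -/
theorem measurableSet_smallGapEvent (n s G₀ : ℕ) : MeasurableSet (smallGapEvent n s G₀) := by
  have h3 : MeasurableSet {ω : BondConfig (Site 2) |
      (∀ v ∈ rectangle n (n + s), v ∈ lowerRegion n ω → v ∉ upperRegion n s ω) ∧
        (gap n s ω).card ≤ G₀} := by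
    refine measurableSet_setOf_of_invariant (explData n s) (measurableSet_explData_fibre n s) ?_
    intro ω ω' h hω
    obtain ⟨h₁, h₂⟩ := Prod.ext_iff.1 h
    rw [lowerRegion_congr n h₁, upperRegion_congr n s h₂, gap_congr n s h₁ h₂] at hω
    exact hω
  have hEq : smallGapEvent n s G₀ = lrCrossing n n ∩ (upperLR n s ∩ {ω : BondConfig (Site 2) |
      (∀ v ∈ rectangle n (n + s), v ∈ lowerRegion n ω → v ∉ upperRegion n s ω) ∧
        (gap n s ω).card ≤ G₀}) := rfl
  rw [hEq]
  exact (measurableSet_lrCrossing n n).inter ((measurableSet_upperLR n s).inter h3)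

/-- The Non-Slant event is measurable. [folklore] -/
theorem measurableSet_nonSlant (m : ℕ) : MeasurableSet (nonSlant m) :=
  measurableSet_setOf_slant m fun x y => 5 * |y 0 - x 0| ≤ 3 * (m : ℤ)

/-! ### The coins of the small square determine the chosen non-slant path -/

/-- The coins of the corners in the square `[0, m]²`. [folklore] -/
def windowCoins (m : ℕ) : Finset (Site 2 × Fin 2) := rectangle m m ×ˢ Finset.univ

/-- Membership in `windowCoins`. [folklore] -/
theorem mem_windowCoins {m : ℕ} {i : Site 2 × Fin 2} : i ∈ windowCoins m ↔ i.1 ∈ rectangle m m := by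
  simp [windowCoins]

/-- Coin sets agreeing on the window coins open the same edges of the square. [folklore] -/
theorem cornerConfig_inter_squareEdgeSet_subset {m : ℕ} {S S' : Set (Site 2 × Fin 2)}
    (h : ∀ i ∈ windowCoins m, i ∈ S ↔ i ∈ S') :
    cornerConfig S ∩ squareEdgeSet m ⊆ cornerConfig S' := by
  rintro e ⟨⟨v, hv⟩, hsq⟩
  rcases hv with ⟨rfl, h0⟩ | ⟨rfl, h01⟩
  · have hvR : v ∈ rectangle m m := hsq v (Sym2.mem_mk_left _ _)
    exact ⟨v, Or.inl ⟨rfl, (h (v, 0) (mem_windowCoins.2 hvR)).1 h0⟩⟩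
  · have hvR : v ∈ rectangle m m := hsq v (Sym2.mem_mk_left _ _)
    refine ⟨v, Or.inr ⟨rfl, ?_⟩⟩
    rw [← h (v, 0) (mem_windowCoins.2 hvR), ← h (v, 1) (mem_windowCoins.2 hvR)]
    exact h01

/-- **The chosen non-slant path is a function of the window coins.** [folklore] -/
theorem nsPath_cornerConfig_congr {m : ℕ} {S S' : Set (Site 2 × Fin 2)}
    (h : ∀ i ∈ windowCoins m, i ∈ S ↔ i ∈ S') :
    nsPath m (cornerConfig S) = nsPath m (cornerConfig S') := by
  apply nsPath_congr
  ext e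
  exact ⟨fun he => ⟨cornerConfig_inter_squareEdgeSet_subset h he, he.2⟩,
    fun he => ⟨cornerConfig_inter_squareEdgeSet_subset (fun i hi => (h i hi).symm) he, he.2⟩⟩

/-- The window coins present in `S`. [folklore] -/
def coinsIn (m : ℕ) (S : Set (Site 2 × Fin 2)) : Finset (Site 2 × Fin 2) := by
  classical exact (windowCoins m).filter (· ∈ S)

/-- Membership in `coinsIn`. [folklore] -/
theorem mem_coinsIn_iff {m : ℕ} {S : Set (Site 2 × Fin 2)} {i : Site 2 × Fin 2} :
    i ∈ coinsIn m S ↔ i ∈ windowCoins m ∧ i ∈ S := by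
  unfold coinsIn
  simp only [Finset.mem_filter]

/-- Coin sets with the same window coins agree on the window. [folklore] -/
theorem forall_iff_of_coinsIn_eq {m : ℕ} {S S' : Set (Site 2 × Fin 2)} (h : coinsIn m S = coinsIn m S') :
    ∀ i ∈ windowCoins m, i ∈ S ↔ i ∈ S' := by
  intro i hi
  have h' := Finset.ext_iff.1 h i
  rw [mem_coinsIn_iff, mem_coinsIn_iff] at h'
  tauto

/-- The fibres of `coinsIn m` are measurable (finite-dimensional cylinders). [folklore] -/
theorem measurableSet_coinsIn_fibre (m : ℕ) (P : Finset (Site 2 × Fin 2)) :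
    MeasurableSet ((coinsIn m) ⁻¹' {P}) := by
  have hEq : (coinsIn m) ⁻¹' {P} = {S : Set (Site 2 × Fin 2) |
      P ⊆ windowCoins m ∧ ∀ i, i ∈ windowCoins m → (i ∈ S ↔ i ∈ P)} := by
    ext S
    simp only [Set.mem_preimage, Set.mem_singleton_iff, Set.mem_setOf_eq]
    constructor
    · rintro rfl
      exact ⟨fun i hi => (mem_coinsIn_iff.1 hi).1,
        fun i hi => ⟨fun hS => mem_coinsIn_iff.2 ⟨hi, hS⟩, fun hP => (mem_coinsIn_iff.1 hP).2⟩⟩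
    · rintro ⟨hP, h⟩
      ext i
      rw [mem_coinsIn_iff]
      exact ⟨fun hi => (h i hi.1).1 hi.2, fun hiP => ⟨hP hiP, (h i (hP hiP)).2 hiP⟩⟩
  rw [hEq]
  exact (measurable_const.and (Measurable.forall fun i =>
    measurable_const.imp ((measurable_set_mem i).iff measurable_const))).setOf

/-! ### The resampling datum enters only through finitely valued data -/

/-- The space of resampling data `q = (S₁, S₂, X)` (local notation). [folklore] -/
local notation "RQ" => Set (Site 2 × Fin 2) × (Set (Site 2 × Fin 2) × Site 2)

/-- The data of the resampling datum `q = (S₁, S₂, X)` through which the link, the junction and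
the goodness of the shift are read: the explored data of `S₁`, the window coins of `S₂`, and `X`.
[cite: BollobasRiordan2010, §5.1 proof of Thm. 5.3] -/
def brData (n s m : ℕ) (q : RQ) :
    (Finset (Site 2) × Finset (Site 2)) × (Finset (Site 2 × Fin 2) × Site 2) :=
  (explData n s (cornerConfig q.1), (coinsIn m q.2.1, q.2.2))

/-- The data map has measurable fibres. [folklore] -/
theorem measurableSet_brData_fibre (n s m : ℕ)
    (d : (Finset (Site 2) × Finset (Site 2)) × (Finset (Site 2 × Fin 2) × Site 2)) :
    MeasurableSet ((brData n s m) ⁻¹' {d}) :=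
  measurableSet_fibre_prodMk (f := fun q : RQ => explData n s (cornerConfig q.1))
    (g := fun q : RQ => (coinsIn m q.2.1, q.2.2))
    (fun b => measurable_fst (measurableSet_explData_cornerConfig_fibre n s b))
    (measurableSet_fibre_prodMk (f := fun q : RQ => coinsIn m q.2.1) (g := fun q : RQ => q.2.2)
      (fun P => (measurable_fst.comp measurable_snd) (measurableSet_coinsIn_fibre m P))
      (fun X => (measurable_snd.comp measurable_snd) (measurableSet_singleton X)))
    d

section BrData

variable {n s m : ℕ} {q q' : RQ}

/-- Same data, same lower region. [folklore] -/
theorem brData_lowerRegion (h : brData n s m q = brData n s m q') :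
    lowerRegion n (cornerConfig q.1) = lowerRegion n (cornerConfig q'.1) :=
  lowerRegion_congr n (congrArg (fun d => d.1.1) h)

/-- Same data, same upper region. [folklore] -/
theorem brData_upperRegion (h : brData n s m q = brData n s m q') :
    upperRegion n s (cornerConfig q.1) = upperRegion n s (cornerConfig q'.1) :=
  upperRegion_congr n s (congrArg (fun d => d.1.2) h)

/-- Same data, same link walk. [folklore] -/
theorem brData_linkWalk (h : brData n s m q = brData n s m q') :
    linkWalk m q.2.1 q.2.2 = linkWalk m q'.2.1 q'.2.2 := by
  have hc : coinsIn m q.2.1 = coinsIn m q'.2.1 := congrArg (fun d => d.2.1) h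
  have hX : q.2.2 = q'.2.2 := congrArg (fun d => d.2.2) h
  unfold linkWalk
  rw [nsPath_cornerConfig_congr (forall_iff_of_coinsIn_eq hc), hX]

/-- Same data, same junction corners. [folklore] -/
theorem brData_juncCorners (h : brData n s m q = brData n s m q') :
    juncCorners n s m q = juncCorners n s m q' := by
  unfold juncCorners
  rw [brData_lowerRegion h, brData_upperRegion h, brData_linkWalk h]

/-- Same data, same modification site. [folklore] -/
theorem brData_juncSite (h : brData n s m q = brData n s m q') :
    juncSite n s m q = juncSite n s m q' := by
  unfold juncSite
  rw [brData_juncCorners h]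

/-- Same data, same imposed pattern. [folklore] -/
theorem brData_juncPattern (h : brData n s m q = brData n s m q') :
    juncPattern n s m q = juncPattern n s m q' := by
  unfold juncPattern
  rw [brData_juncCorners h]

end BrData

/-- **The event that the shift is good** (Bollobás–Riordan's "`X ∈ C'_i`", choice-free): the
link walk `nsPath m (cornerConfig S₂) + X` starts in the lower region `A` of `S₁`, ends in its
upper region `B`, and stays in the strip `0 ≤ z₀ ≤ n`. [cite: BollobasRiordan2010, §5.1 proof of Thm. 5.3] -/
def goodSet (n s m : ℕ) : Set RQ :=
  {q | (linkWalk m q.2.1 q.2.2).fst ∈ lowerRegion n (cornerConfig q.1) ∧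
    (linkWalk m q.2.1 q.2.2).snd ∈ upperRegion n s (cornerConfig q.1) ∧
    ∀ z ∈ (linkWalk m q.2.1 q.2.2).walk.support, 0 ≤ z 0 ∧ z 0 ≤ n}

/-- Membership in the good-shift event. [folklore] -/
theorem mem_goodSet_iff {n s m : ℕ} {q : RQ} : q ∈ goodSet n s m ↔
    (linkWalk m q.2.1 q.2.2).fst ∈ lowerRegion n (cornerConfig q.1) ∧
      (linkWalk m q.2.1 q.2.2).snd ∈ upperRegion n s (cornerConfig q.1) ∧
      ∀ z ∈ (linkWalk m q.2.1 q.2.2).walk.support, 0 ≤ z 0 ∧ z 0 ≤ n := Iff.rfl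

/-- Goodness only depends on the data. [folklore] -/
theorem brData_goodSet {n s m : ℕ} {q q' : RQ} (h : brData n s m q = brData n s m q')
    (hq : q ∈ goodSet n s m) : q' ∈ goodSet n s m := by
  rw [mem_goodSet_iff] at hq ⊢
  rw [← brData_lowerRegion h, ← brData_upperRegion h, ← brData_linkWalk h]
  exact hq

/-- The good-shift event is measurable. [folklore] -/
theorem measurableSet_goodSet (n s m : ℕ) : MeasurableSet (goodSet n s m) :=
  measurableSet_setOf_of_invariant (brData n s m) (measurableSet_brData_fibre n s m)
    (p := fun q => q ∈ goodSet n s m) fun _ _ h hq => brData_goodSet h hq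

/-- The joint level sets of the modification site and the imposed pattern are measurable.
[folklore] -/
theorem measurableSet_juncSite_juncPattern_eq (n s m : ℕ) (K P : Finset (Site 2 × Fin 2)) :
    MeasurableSet {q : RQ | juncSite n s m q = K ∧ juncPattern n s m q = P} :=
  measurableSet_setOf_of_invariant (brData n s m) (measurableSet_brData_fibre n s m)
    (p := fun q => juncSite n s m q = K ∧ juncPattern n s m q = P) fun _ _ h hq => by
      rw [← brData_juncSite h, ← brData_juncPattern h]
      exact hq

/-- The level sets of the modification site are measurable. [folklore] -/
theorem measurableSet_juncSite_eq (n s m : ℕ) (K : Finset (Site 2 × Fin 2)) :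
    MeasurableSet {q : RQ | juncSite n s m q = K} :=
  measurableSet_setOf_of_invariant (brData n s m) (measurableSet_brData_fibre n s m)
    (p := fun q => juncSite n s m q = K) fun _ _ h hq => by
      rw [← brData_juncSite h]
      exact hq

/-! ### Registered glue -/

/-- Statement form of `isStoppingSet_examinedCoins` — "under `ExaminedStatement` the examined
coins form a stopping set": a registered glue step the LINE POSITS and proves right below
(`examinedStopping_holds`); not a literature fact, never to be relocated. -/
def ExaminedStoppingStatement : Prop :=
  ExaminedStatement → ∀ n s : ℕ, IsStoppingSet (examinedCoins n s)

/-- The examined coins form a stopping set. [cite: BollobasRiordan2010, §5.1 proof of Thm. 5.3] -/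
theorem examinedStopping_holds : ExaminedStoppingStatement := fun h n s => isStoppingSet_examinedCoins h n s

end Summit.CriticalPhenomena.CardyFormulaZ2.Cruxes.UniformBoxCrossing.NonSlantLine

end
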